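import Summits.Ventures.PercRepro.S1TriangleUnionGeneral

/-!
# PercRepro — THE RANK OF A SET IN A DISJOINT SUM, AND THE `U` / `Y` SETS OF THE C-025 BODY THERE (p2, gen 27;
SUBCLAIM-S1 §6.10 (xvii)(d))

The first tool of the «consumer that sees 1-separations»: in `M.disjointSum N h` the rank of a set is the sum of
the ranks of its traces on the two ground sets (a basis of the trace on each side unites to a basis), so the
`U`-set of the C-025 body at `(p, q)` is the set of `A` whose two traces are spanning with complements of ranks
`b₁ + b₂ = q`, and the `Y`-set the set of `A` whose two trace ranks sum into `(q, p)`. Nothing is claimed about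
any cell.

* **`disjointSum_eRk_eq`** — `eRk (M ⊕ N) X = eRk M (X ∩ M.E) + eRk N (X ∩ N.E)`;
* `disjointSum_eRk_sdiff_eq` — the same for the complement `(M.E ∪ N.E) \ X`;
* **`disjointSum_mem_U_iff`**, **`disjointSum_mem_Y_iff`** — the two membership characterisations;
* `mem_closure_iff_eRk_insert_eq`, **`disjointSum_mem_closure_iff_left`** / `_right` — closure in a disjoint sum, trace by trace;
The free / coloop-free / circuit transfers are in S1DisjointSumCore.
Axioms: standard.
-/

open scoped Matroid

namespace PercRepro

namespace S1

open Set

variable {α : Type}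

/-- **The rank of a set in a disjoint sum** is the sum of the ranks of its two traces. -/
theorem disjointSum_eRk_eq (M N : Matroid α) (h : Disjoint M.E N.E) (X : Set α) (hX : X ⊆ M.E ∪ N.E) :
    (M.disjointSum N h).eRk X = M.eRk (X ∩ M.E) + N.eRk (X ∩ N.E) := by
  obtain ⟨I, hI⟩ := M.exists_isBasis (X ∩ M.E) inter_subset_right
  obtain ⟨J, hJ⟩ := N.exists_isBasis (X ∩ N.E) inter_subset_right
  have hIM : I ⊆ M.E := hI.indep.subset_ground
  have hJN : J ⊆ N.E := hJ.indep.subset_ground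
  have hIX : I ⊆ X := hI.subset.trans inter_subset_left
  have hJX : J ⊆ X := hJ.subset.trans inter_subset_left
  have hIJ : Disjoint I J := h.mono hIM hJN
  have h1 : (I ∪ J) ∩ M.E = I := by
    ext x
    constructor
    · rintro ⟨hx | hx, hxM⟩
      · exact hx
      · exact absurd hxM (h.symm.notMem_of_mem_left (hJN hx))
    · intro hx; exact ⟨Or.inl hx, hIM hx⟩
  have h2 : (I ∪ J) ∩ N.E = J := by
    ext x
    constructor
    · rintro ⟨hx | hx, hxN⟩
      · exact absurd hxN (h.notMem_of_mem_left (hIM hx))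
      · exact hx
    · intro hx; exact ⟨Or.inr hx, hJN hx⟩
  have hB : (M.disjointSum N h).IsBasis (I ∪ J) X := by
    rw [Matroid.disjointSum_isBasis_iff, h1, h2]
    exact ⟨hI, hJ, union_subset hIX hJX, hX⟩
  rw [hB.eRk_eq_encard, Set.encard_union_eq hIJ, hI.encard_eq_eRk, hJ.encard_eq_eRk]

/-- The rank of the complement of `X` in a disjoint sum, trace by trace. -/
theorem disjointSum_eRk_sdiff_eq (M N : Matroid α) (h : Disjoint M.E N.E) (X : Set α) :
    (M.disjointSum N h).eRk ((M.E ∪ N.E) \ X) = M.eRk (M.E \ X) + N.eRk (N.E \ X) := by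
  rw [disjointSum_eRk_eq M N h _ sdiff_subset]
  congr 2
  · ext x; simp only [mem_inter_iff, mem_sdiff, mem_union]; tauto
  · ext x; simp only [mem_inter_iff, mem_sdiff, mem_union]; tauto

/-- **Membership in the `U`-set of the C-025 body of a disjoint sum**: `A ⊆ E` with `ρ(A) = p` and
`ρ(E ∖ A) = q` iff its traces have ranks `a₁ + a₂ = p` and complements of ranks `b₁ + b₂ = q`. -/
theorem disjointSum_mem_U_iff (M N : Matroid α) [M.Finite] [N.Finite] (h : Disjoint M.E N.E) (p q : ℕ)
    (A : Set α) :
    (A ⊆ (M.disjointSum N h).E ∧ (M.disjointSum N h).eRk A = p ∧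
        (M.disjointSum N h).eRk ((M.disjointSum N h).E \ A) = q) ↔
      A ⊆ M.E ∪ N.E ∧ ∃ a₁ a₂ b₁ b₂ : ℕ, a₁ + a₂ = p ∧ b₁ + b₂ = q ∧
        M.eRk (A ∩ M.E) = a₁ ∧ N.eRk (A ∩ N.E) = a₂ ∧ M.eRk (M.E \ A) = b₁ ∧ N.eRk (N.E \ A) = b₂ := by
  rw [Matroid.disjointSum_ground_eq]
  constructor
  · rintro ⟨hA, hp, hq⟩
    rw [disjointSum_eRk_eq M N h A hA] at hp
    rw [disjointSum_eRk_sdiff_eq] at hq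
    have hfin : ∀ (K : Matroid α) [K.Finite] (X : Set α), K.eRk X ≠ ⊤ := by
      intro K _ X
      rw [← K.eRk_inter_ground X]
      exact ((K.eRk_le_encard _).trans_lt (K.ground_finite.subset inter_subset_right).encard_lt_top).ne
    obtain ⟨a₁, ha₁⟩ := ENat.ne_top_iff_exists.1 (hfin M (A ∩ M.E))
    obtain ⟨a₂, ha₂⟩ := ENat.ne_top_iff_exists.1 (hfin N (A ∩ N.E))
    obtain ⟨b₁, hb₁⟩ := ENat.ne_top_iff_exists.1 (hfin M (M.E \ A))
    obtain ⟨b₂, hb₂⟩ := ENat.ne_top_iff_exists.1 (hfin N (N.E \ A))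
    refine ⟨hA, a₁, a₂, b₁, b₂, ?_, ?_, ha₁.symm, ha₂.symm, hb₁.symm, hb₂.symm⟩
    · rw [← ha₁, ← ha₂] at hp; exact_mod_cast hp
    · rw [← hb₁, ← hb₂] at hq; exact_mod_cast hq
  · rintro ⟨hA, a₁, a₂, b₁, b₂, hp, hq, ha₁, ha₂, hb₁, hb₂⟩
    refine ⟨hA, ?_, ?_⟩
    · rw [disjointSum_eRk_eq M N h A hA, ha₁, ha₂, ← hp]; push_cast; rfl
    · rw [disjointSum_eRk_sdiff_eq, hb₁, hb₂, ← hq]; push_cast; rfl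

/-- **Membership in the `Y`-set of the C-025 body of a disjoint sum**: `q < ρ(A) < p` iff the trace ranks
`a₁, a₂` satisfy `q < a₁ + a₂ < p`. -/
theorem disjointSum_mem_Y_iff (M N : Matroid α) [M.Finite] [N.Finite] (h : Disjoint M.E N.E) (p q : ℕ)
    (A : Set α) :
    (A ⊆ (M.disjointSum N h).E ∧ (q : ℕ∞) < (M.disjointSum N h).eRk A ∧ (M.disjointSum N h).eRk A < p) ↔
      A ⊆ M.E ∪ N.E ∧ ∃ a₁ a₂ : ℕ, q < a₁ + a₂ ∧ a₁ + a₂ < p ∧ M.eRk (A ∩ M.E) = a₁ ∧ N.eRk (A ∩ N.E) = a₂ := by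
  rw [Matroid.disjointSum_ground_eq]
  constructor
  · rintro ⟨hA, hq, hp⟩
    rw [disjointSum_eRk_eq M N h A hA] at hq hp
    have hfin : ∀ (K : Matroid α) [K.Finite] (X : Set α), K.eRk X ≠ ⊤ := by
      intro K _ X
      rw [← K.eRk_inter_ground X]
      exact ((K.eRk_le_encard _).trans_lt (K.ground_finite.subset inter_subset_right).encard_lt_top).ne
    obtain ⟨a₁, ha₁⟩ := ENat.ne_top_iff_exists.1 (hfin M (A ∩ M.E))
    obtain ⟨a₂, ha₂⟩ := ENat.ne_top_iff_exists.1 (hfin N (A ∩ N.E))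
    rw [← ha₁, ← ha₂] at hq hp
    exact ⟨hA, a₁, a₂, by exact_mod_cast hq, by exact_mod_cast hp, ha₁.symm, ha₂.symm⟩
  · rintro ⟨hA, a₁, a₂, hq, hp, ha₁, ha₂⟩
    refine ⟨hA, ?_, ?_⟩
    · rw [disjointSum_eRk_eq M N h A hA, ha₁, ha₂]; exact_mod_cast hq
    · rw [disjointSum_eRk_eq M N h A hA, ha₁, ha₂]; exact_mod_cast hp

/-- `e ∈ E` lies in the closure of `X ⊆ E` iff adding it does not raise the rank. -/
theorem mem_closure_iff_eRk_insert_eq (M : Matroid α) [M.Finite] {e : α} (he : e ∈ M.E) {X : Set α}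
    (hX : X ⊆ M.E) : e ∈ M.closure X ↔ M.eRk (insert e X) = M.eRk X := by
  constructor
  · intro h
    rw [← M.eRk_closure_eq (insert e X), Matroid.closure_insert_eq_of_mem_closure h, M.eRk_closure_eq]
  · intro h
    by_contra hne
    have h1 := Matroid.eRk_insert_eq_add_one ⟨he, hne⟩
    rw [h] at h1
    have hfin : M.eRk X ≠ ⊤ := ((M.eRk_le_encard X).trans_lt (M.ground_finite.subset hX).encard_lt_top).ne
    obtain ⟨r, hr⟩ := ENat.ne_top_iff_exists.1 hfin
    rw [← hr] at h1
    have : r = r + 1 := by exact_mod_cast h1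
    omega

/-- The disjoint sum of two finite matroids is finite. -/
theorem disjointSum_finite (M N : Matroid α) [M.Finite] [N.Finite] (h : Disjoint M.E N.E) :
    (M.disjointSum N h).Finite :=
  ⟨by rw [Matroid.disjointSum_ground_eq]; exact M.ground_finite.union N.ground_finite⟩

/-- **Closure in a disjoint sum, left trace**: for `e ∈ M.E`, `e ∈ cl_{M ⊕ N}(X)` iff `e ∈ cl_M(X ∩ M.E)`. -/
theorem disjointSum_mem_closure_iff_left (M N : Matroid α) [M.Finite] [N.Finite] (h : Disjoint M.E N.E)
    {e : α} (he : e ∈ M.E) {X : Set α} (hX : X ⊆ M.E ∪ N.E) :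
    e ∈ (M.disjointSum N h).closure X ↔ e ∈ M.closure (X ∩ M.E) := by
  haveI := disjointSum_finite M N h
  have heE : e ∈ (M.disjointSum N h).E := by rw [Matroid.disjointSum_ground_eq]; exact Or.inl he
  have hXE : X ⊆ (M.disjointSum N h).E := by rw [Matroid.disjointSum_ground_eq]; exact hX
  have heN : e ∉ N.E := h.notMem_of_mem_left he
  rw [mem_closure_iff_eRk_insert_eq _ heE hXE, mem_closure_iff_eRk_insert_eq M he inter_subset_right,
    disjointSum_eRk_eq M N h X hX, disjointSum_eRk_eq M N h (insert e X) (insert_subset (Or.inl he) hX)]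
  have h1 : insert e X ∩ M.E = insert e (X ∩ M.E) := by
    ext x; simp only [mem_inter_iff, mem_insert_iff]
    constructor
    · rintro ⟨hx | hx, hxM⟩
      · exact Or.inl hx
      · exact Or.inr ⟨hx, hxM⟩
    · rintro (rfl | ⟨hx, hxM⟩)
      · exact ⟨Or.inl rfl, he⟩
      · exact ⟨Or.inr hx, hxM⟩
  have h2 : insert e X ∩ N.E = X ∩ N.E := by
    ext x; simp only [mem_inter_iff, mem_insert_iff]
    constructor
    · rintro ⟨hx | hx, hxN⟩
      · subst hx; exact absurd hxN heN
      · exact ⟨hx, hxN⟩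
    · rintro ⟨hx, hxN⟩; exact ⟨Or.inr hx, hxN⟩
  rw [h1, h2]
  have hfinN : N.eRk (X ∩ N.E) ≠ ⊤ :=
    ((N.eRk_le_encard _).trans_lt (N.ground_finite.subset inter_subset_right).encard_lt_top).ne
  constructor
  · intro hsum
    exact WithTop.add_right_cancel hfinN hsum
  · intro heq; rw [heq]

/-- **Closure in a disjoint sum, right trace**. -/
theorem disjointSum_mem_closure_iff_right (M N : Matroid α) [M.Finite] [N.Finite] (h : Disjoint M.E N.E)
    {e : α} (he : e ∈ N.E) {X : Set α} (hX : X ⊆ M.E ∪ N.E) :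
    e ∈ (M.disjointSum N h).closure X ↔ e ∈ N.closure (X ∩ N.E) := by
  rw [Matroid.disjointSum_comm]
  exact disjointSum_mem_closure_iff_left N M h.symm he (by rw [union_comm]; exact hX)

end S1

end PercRepro
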